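import Summits.QuantumFields.YangMills.Theorems.IR.Negative.TypShellCondFalseAllG
import Summits.QuantumFields.YangMills.Theorems.IR.AfPincerUcFormat
import Summits.QuantumFields.YangMills.Theorems.BalabanLadderIRAfOnsetPlaquetteMoments
import Summits.QuantumFields.YangMills.Theorems.EquipartitionCriticalityFreeEnergyLogCoefficientStubExpChartPackage

/-!
# Crux `IR` (stmt-QuantumFields-19354) — the POLYNOMIAL ROW FLOOR `b⋆_T(β) ≥ c·(β / log β)^{1/7}` for EVERY compact gauge group,
# part 1/10: §1 energy–entropy tail of a Gibbs tilt, telescoping; §2 the fixed-mesh composition made pointwise in (b, β) (sections `GibbsTail`, `Telescoping`, `Core`)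

Re-homed VERBATIM (statements, proofs, names; namespace `…Cruxes.IR.CruxIdea2g7` ↦ `…Cruxes.IR.RowFloorPoly`) from the crux
workfile `Cruxes/IR/CruxIdea2RowFloorPoly.lean` rev 14 (sha16 742d7312ea0b5c70; author `ym-cruxidea-19354-2` GEN 7; kernel certificate
`Cruxes/IR/CruxIdea2RowFloorPolyCert.lean` rev 1, sha16 59d3cfe64fab9c7c, gate-elaborated stub-free) per owner R114 (2) (landing seat:
the `ym-19354-disprove-1` lineage, g9), split by its sections into ten ≤ 400-line modules chained by import; the module docstring of
record (history, theorem map, honest framing) is in the headline module `Theorems/IR/Negative/TypOnsetFloorPoly.lean` (part 10/10).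
Negative knowledge for stmt-QuantumFields-19354 (`--supports`; closes no stub); not mixing, not a mass gap, nothing about Clay.
-/

set_option autoImplicit false

noncomputable section

open MeasureTheory Filter Topology
open Literature.MathematicalPhysics.QuantumLattice
open Literature.Probability.LatticeModels
open Summit.QuantumFields.YangMills.Cruxes.IR.Tempered (cellEdges windowCells regionEdges)
open Summit.QuantumFields.YangMills.Cruxes.IR.ShellTempered (windowCellsPlus)
open Summit.QuantumFields.YangMills.Cruxes.IR.OnsetFormats (TypShellCond shellCount)
open Summit.QuantumFields.YangMills.Cruxes.IR.FixedMesh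
open Summit.QuantumFields.YangMills.Cruxes.IR.FixedMeshAllG

namespace Summit.QuantumFields.YangMills.Cruxes.IR.RowFloorPoly

/-! ## §1 Two abstract lemmas (PROVED): the energy–entropy tail of a Gibbs tilt; telescoping for products -/

section GibbsTail

variable {X : Type*} [MeasurableSpace X]

/-- **Energy–entropy tail (PROVED).**  `μ` a probability measure, `A ≥ 0` measurable, `β ≥ 0`, and a sub-level
`{A ≤ s}` of positive `μ`-mass.  The Gibbs tilt `ν_β = μ.tilted (−β A)` (density `e^{-βA}/Z_β`) satisfies
`ν_β {a < A} ≤ e^{-β (a - s)} / μ{A ≤ s}`.  Proof: `Z_β ≥ e^{-β s} μ{A ≤ s}` and `e^{-βA} ≤ e^{-β a}` on `{a < A}`. -/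
theorem gibbsTail_le (μ : Measure X) [IsProbabilityMeasure μ] {A : X → ℝ} (hAm : Measurable A)
    (hA0 : ∀ x, 0 ≤ A x) {β : ℝ} (hβ : 0 ≤ β) (a s : ℝ) (hs : 0 < μ.real {x | A x ≤ s}) :
    (μ.tilted fun x => -(β * A x)).real {x | a < A x} ≤
      Real.exp (-(β * (a - s))) / μ.real {x | A x ≤ s} := by
  set w : X → ℝ := fun x => Real.exp (-(β * A x)) with hw
  have hwm : Measurable w := (Real.measurable_exp.comp ((hAm.const_mul β).neg))
  have hw0 : ∀ x, 0 < w x := fun x => Real.exp_pos _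
  have hw1 : ∀ x, w x ≤ 1 := fun x => by
    show Real.exp (-(β * A x)) ≤ 1
    rw [Real.exp_le_one_iff]
    have := mul_nonneg hβ (hA0 x)
    linarith
  have hwi : Integrable w μ :=
    (integrable_const (1 : ℝ)).mono' hwm.aestronglyMeasurable
      (ae_of_all _ fun x => by rw [Real.norm_eq_abs, abs_of_pos (hw0 x)]; exact hw1 x)
  set Z : ℝ := ∫ x, w x ∂μ with hZ
  have hSm : MeasurableSet {x | A x ≤ s} := measurableSet_le hAm measurable_const
  have hTm : MeasurableSet {x | a < A x} := measurableSet_lt measurable_const hAm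
  -- the partition function is at least the sub-level contribution
  have hZlow : Real.exp (-(β * s)) * μ.real {x | A x ≤ s} ≤ Z := by
    calc Real.exp (-(β * s)) * μ.real {x | A x ≤ s}
        = ∫ x in {x | A x ≤ s}, Real.exp (-(β * s)) ∂μ := by
          rw [setIntegral_const, smul_eq_mul, mul_comm]
      _ ≤ ∫ x in {x | A x ≤ s}, w x ∂μ := by
          refine setIntegral_mono_on (integrable_const _).integrableOn hwi.integrableOn hSm fun x hx => ?_
          have hx' : A x ≤ s := hx
          exact Real.exp_le_exp.2 (neg_le_neg (mul_le_mul_of_nonneg_left hx' hβ))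
      _ ≤ Z := setIntegral_le_integral hwi (ae_of_all _ fun x => (hw0 x).le)
  have hZpos : 0 < Z := lt_of_lt_of_le (mul_pos (Real.exp_pos _) hs) hZlow
  -- the tilted mass of `{a < A}` as a real integral
  have hreal : (μ.tilted fun x => -(β * A x)).real {x | a < A x} =
      ∫ x in {x | a < A x}, w x / Z ∂μ := by
    rw [measureReal_def, tilted_apply_eq_ofReal_integral' _ hTm, ENNReal.toReal_ofReal]
    exact integral_nonneg fun x => div_nonneg (Real.exp_pos _).le hZpos.le
  -- on `{a < A}` the weight is at most `e^{-β a}`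
  have hbound : ∫ x in {x | a < A x}, w x / Z ∂μ ≤ ∫ x in {x | a < A x}, Real.exp (-(β * a)) / Z ∂μ := by
    refine setIntegral_mono_on (hwi.div_const Z).integrableOn (integrable_const _).integrableOn hTm
      fun x hx => ?_
    have hx' : a < A x := hx
    exact div_le_div_of_nonneg_right
      (Real.exp_le_exp.2 (neg_le_neg (mul_le_mul_of_nonneg_left hx'.le hβ))) hZpos.le
  have hmass : ∫ x in {x | a < A x}, Real.exp (-(β * a)) / Z ∂μ ≤ Real.exp (-(β * a)) / Z := by
    rw [setIntegral_const, smul_eq_mul]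
    have h1 : μ.real {x | a < A x} ≤ 1 := measureReal_le_one
    have h2 : 0 ≤ Real.exp (-(β * a)) / Z := div_nonneg (Real.exp_pos _).le hZpos.le
    nlinarith
  have hfin : Real.exp (-(β * a)) / Z ≤ Real.exp (-(β * (a - s))) / μ.real {x | A x ≤ s} := by
    have hden : 0 < Real.exp (-(β * s)) * μ.real {x | A x ≤ s} := mul_pos (Real.exp_pos _) hs
    calc Real.exp (-(β * a)) / Z
        ≤ Real.exp (-(β * a)) / (Real.exp (-(β * s)) * μ.real {x | A x ≤ s}) :=
          div_le_div_of_nonneg_left (Real.exp_pos _).le hden hZlow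
      _ = Real.exp (-(β * (a - s))) / μ.real {x | A x ≤ s} := by
          rw [← div_div, ← Real.exp_sub]
          congr 2
          ring
  rw [hreal]
  exact hbound.trans (hmass.trans hfin)

/-- **Energy–entropy tail, entropy form (PROVED).**  With `β > 0`: `A ≤ s + (log (1/μ{A ≤ s}) + t)/β` off a set of
`ν_β`-mass `≤ e^{-t}`.  In the application `μ` = product Haar on the region's links, `A` = the Wilson boundary action
of the region given the frozen exterior `ζ`, `s = A(ζ's own filling) + m/β` and `μ{A ≤ s} ≥` the Haar mass of a product
of balls of radius `∝ 1/(β · #touching plaquettes)`: `log (1/μ{A ≤ s}) ≤ C_G · m · log β` (`m` = number of links). -/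
theorem gibbsTail_le_exp_neg (μ : Measure X) [IsProbabilityMeasure μ] {A : X → ℝ} (hAm : Measurable A)
    (hA0 : ∀ x, 0 ≤ A x) {β : ℝ} (hβ : 0 < β) (s t : ℝ) (hs : 0 < μ.real {x | A x ≤ s}) :
    (μ.tilted fun x => -(β * A x)).real
        {x | s + (Real.log (1 / μ.real {x | A x ≤ s}) + t) / β < A x} ≤ Real.exp (-t) := by
  have h := gibbsTail_le μ hAm hA0 hβ.le (s + (Real.log (1 / μ.real {x | A x ≤ s}) + t) / β) s hs
  refine h.trans (le_of_eq ?_)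
  have hm : 0 < μ.real {x | A x ≤ s} := hs
  have e1 : β * (s + (Real.log (1 / μ.real {x | A x ≤ s}) + t) / β - s) =
      Real.log (1 / μ.real {x | A x ≤ s}) + t := by
    field_simp
    ring
  rw [e1, neg_add, Real.exp_add, Real.exp_neg, Real.exp_log (one_div_pos.2 hm), one_div, inv_inv,
    mul_comm, mul_div_assoc, div_self hm.ne', mul_one]

/-- **Energy–entropy MEAN bound, abstract (PROVED; rev 9).**  For the Gibbs tilt `ν_β = μ.tilted (−βA)` of a probability
measure by a measurable `0 ≤ A ≤ M` and any level `a ≥ 0`:  `E_{ν_β} A ≤ a + M · ν_β{a < A}` — the form in which step (b)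
of the §5 plan consumes the tail bound (`E_γ A ≤ a + 2N·#touching · γ{A > a}`). -/
theorem gibbsMean_le_of_tail (μ : Measure X) [IsProbabilityMeasure μ] {A : X → ℝ} (hAm : Measurable A)
    (hA0 : ∀ x, 0 ≤ A x) {M : ℝ} (hAM : ∀ x, A x ≤ M) (β : ℝ) {a r : ℝ} (ha : 0 ≤ a)
    (htail : (μ.tilted fun x => -(β * A x)).real {x | a < A x} ≤ r) :
    ∫ x, A x ∂(μ.tilted fun x => -(β * A x)) ≤ a + M * r := by
  set ν := μ.tilted fun x => -(β * A x) with hν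
  have hexp : Integrable (fun x => Real.exp (-(β * A x))) μ := by
    refine Integrable.of_bound ((hAm.const_mul β).neg.exp.aestronglyMeasurable) (Real.exp (|β| * M))
      (ae_of_all _ fun x => ?_)
    rw [Real.norm_eq_abs, abs_of_pos (Real.exp_pos _), Real.exp_le_exp]
    calc -(β * A x) ≤ |β * A x| := neg_le_abs _
      _ = |β| * A x := by rw [abs_mul, abs_of_nonneg (hA0 x)]
      _ ≤ |β| * M := mul_le_mul_of_nonneg_left (hAM x) (abs_nonneg β)
  haveI : IsProbabilityMeasure ν := isProbabilityMeasure_tilted hexp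
  have hS : MeasurableSet {x | a < A x} := measurableSet_lt measurable_const hAm
  by_cases hM : 0 ≤ M
  swap
  · have hX : IsEmpty X :=
      ⟨fun x => (not_le.2 (lt_of_le_of_lt (hA0 x) (lt_of_le_of_lt (hAM x) (not_le.1 hM)))) le_rfl⟩
    have : (ν : Measure X) = 0 := Measure.eq_zero_of_isEmpty ν
    exact absurd (IsProbabilityMeasure.ne_zero ν) (by simpa using this)
  have hpt : ∀ x, A x ≤ a + M * Set.indicator {x | a < A x} (1 : X → ℝ) x := by
    intro x
    by_cases hx : a < A x
    · have hmem : x ∈ {x | a < A x} := hx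
      rw [Set.indicator_of_mem hmem]
      simp only [Pi.one_apply, mul_one]
      linarith [hAM x]
    · have hnm : x ∉ {x | a < A x} := hx
      rw [Set.indicator_of_notMem hnm, mul_zero, add_zero]
      exact not_lt.1 hx
  have hintA : Integrable A ν := Integrable.of_bound hAm.aestronglyMeasurable M
    (ae_of_all _ fun x => by rw [Real.norm_eq_abs, abs_of_nonneg (hA0 x)]; exact hAM x)
  have hintI : Integrable (fun x => Set.indicator {x | a < A x} (1 : X → ℝ) x) ν :=
    show Integrable (fun x => Set.indicator {x | a < A x} (1 : X → ℝ) x) ν from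
      (integrable_const (1 : ℝ)).indicator hS
  have hint2 : Integrable (fun x => a + M * Set.indicator {x | a < A x} (1 : X → ℝ) x) ν :=
    (integrable_const a).add (hintI.const_mul M)
  calc ∫ x, A x ∂ν ≤ ∫ x, (a + M * Set.indicator {x | a < A x} (1 : X → ℝ) x) ∂ν :=
        integral_mono hintA hint2 hpt
    _ = a + M * ν.real {x | a < A x} := by
        rw [integral_add (integrable_const a) (hintI.const_mul M), integral_const, integral_const_mul,
          integral_indicator_one hS]
        simp
    _ ≤ a + M * r := by gcongr

/-- **Energy–entropy MEAN bound, entropy form (PROVED; rev 9):** `β > 0`, measurable `0 ≤ A ≤ M`, `s, t ≥ 0`,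
`μ{A ≤ s} > 0` ⇒ `E_{ν_β} A ≤ s + (log(1/μ{A ≤ s}) + t)/β + M e^{−t}`. -/
theorem gibbsMean_le (μ : Measure X) [IsProbabilityMeasure μ] {A : X → ℝ} (hAm : Measurable A)
    (hA0 : ∀ x, 0 ≤ A x) {M : ℝ} (hAM : ∀ x, A x ≤ M) {β : ℝ} (hβ : 0 < β) {s t : ℝ}
    (hs0 : 0 ≤ s) (ht : 0 ≤ t) (hs : 0 < μ.real {x | A x ≤ s}) :
    ∫ x, A x ∂(μ.tilted fun x => -(β * A x)) ≤
      s + (Real.log (1 / μ.real {x | A x ≤ s}) + t) / β + M * Real.exp (-t) := by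
  have hm1 : μ.real {x | A x ≤ s} ≤ 1 :=
    (measureReal_mono (Set.subset_univ _)).trans_eq probReal_univ
  have hlog : 0 ≤ Real.log (1 / μ.real {x | A x ≤ s}) := Real.log_nonneg (one_le_one_div hs hm1)
  have ha : 0 ≤ s + (Real.log (1 / μ.real {x | A x ≤ s}) + t) / β := by positivity
  exact gibbsMean_le_of_tail μ hAm hA0 hAM β ha (gibbsTail_le_exp_neg μ hAm hA0 hβ s t hs)

end GibbsTail

section Telescoping

variable {R : Type*} [NormedRing R]

/-- **Telescoping (PROVED).**  In a normed ring, for factors of norm `≤ 1`:  `‖V₁ ⋯ V_k − 1‖ ≤ ∑ ‖Vᵢ − 1‖`.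
With `Vᵢ = ρ(lasso holonomy of the i-th curtain plaquette)` (unitary, Frobenius∕operator norm) this is the
quantitative non-abelian Stokes bound `‖ρ(hol ∂Σ) − 1‖ ≤ ∑_{p ∈ Σ} ‖ρ(U_p) − 1‖` used by both stubs of §5. -/
theorem norm_list_prod_sub_one_le (l : List R) (hl : ∀ x ∈ l, ‖x‖ ≤ 1) :
    ‖l.prod - 1‖ ≤ (l.map fun x => ‖x - 1‖).sum := by
  induction l with
  | nil => simp
  | cons a l ih =>
    have ha : ‖a‖ ≤ 1 := hl a (by simp)
    have ih' : ‖l.prod - 1‖ ≤ (l.map fun x => ‖x - 1‖).sum := ih fun x hx => hl x (by simp [hx])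
    rw [List.prod_cons, List.map_cons, List.sum_cons]
    have hsplit : a * l.prod - 1 = a * (l.prod - 1) + (a - 1) := by noncomm_ring
    calc ‖a * l.prod - 1‖ = ‖a * (l.prod - 1) + (a - 1)‖ := by rw [hsplit]
      _ ≤ ‖a * (l.prod - 1)‖ + ‖a - 1‖ := norm_add_le _ _
      _ ≤ ‖a‖ * ‖l.prod - 1‖ + ‖a - 1‖ := by gcongr; exact norm_mul_le _ _
      _ ≤ 1 * ‖l.prod - 1‖ + ‖a - 1‖ := by gcongr
      _ ≤ ‖a - 1‖ + (l.map fun x => ‖x - 1‖).sum := by linarith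

end Telescoping

/-! ## §2 GEN 6's composition made POINTWISE in `(b, β)` (PROVED — `FixedMeshAllG.frame_core` verbatim, the two
`∃ β₀` packages replaced by numeric hypotheses at this `(b, β)`) -/

section Core

open Literature.MathematicalPhysics.QuantumFieldTheory (wilsonMeasure GaugeConfig isProbabilityMeasure_wilsonMeasure)

variable {G : Type} [Group G] [TopologicalSpace G] [IsTopologicalGroup G] [CompactSpace G]
  [SecondCountableTopology G] [MeasurableSpace G] [BorelSpace G]
  {N : ℕ} (ρ : G →* Matrix (Fin N) (Fin N) ℂ)

/-- **THE FRAME-TWIST ROW — CORE AT ONE `(b, β)` (PROVED).**  As `FixedMeshAllG.frame_core`, but the freezing input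
(`hfreeze0 : 1 − s²/(A+1) ≤ E_{L_b,β}[W ∘ lift]`, `L_b = 2((2n+2)b+1)+1`, rectangle `b × (2n+1)b`) and INPUT F
(`hFat : μ_{L_b,β}{v + s < twisted shaped mean} ≤ s`) are HYPOTHESES AT THIS `(b, β)`, and the budget `s` is a free
parameter with `0 < s ≤ 1/8`, `s ≤ (1 − v − 2ε)/4`.  Conclusion: no measurable cell-local class satisfies clause (i) at
the row together with the single-cell torus anchor `δ` at this `(b, β)`.  This is the form a RATE can be fed into. -/
theorem frame_core_at (hρ : Continuous ρ)
    (hρu : ∀ g, ρ g ∈ Matrix.unitaryGroup (Fin N) ℂ)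
    {b : ℕ} (hb : 1 ≤ b) (n : ℕ) (κ : LGConfig 4 G → Site 4 → G)
    {ψ : ℝ → ℝ} (hψ : Continuous ψ) (hψ1 : ∀ t, |t| ≤ 1 → |ψ t| ≤ 1)
    {A : ℝ} (hA : 0 ≤ A) (hψA : ∀ t, t ≤ 1 → 1 - ψ t ≤ A * (1 - t)) {v : ℝ}
    (hT : TopTwistTransfer ρ κ b n) {β ε δ s : ℝ} (hs0 : 0 < s) (hs8 : s ≤ 1 / 8)
    (hs4 : s ≤ (1 - v - 2 * ε) / 4)
    (hfreeze0 : 1 - s * s / (A + 1) ≤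
      ∫ V, loopObs ρ b ((2 * n + 1) * b) (torusLift (2 * ((2 * n + 2) * b + 1) + 1) V)
        ∂(wilsonMeasure (d := 4) (L := 2 * ((2 * n + 2) * b + 1) + 1) ρ β))
    (hFat : (wilsonMeasure (d := 4) (L := 2 * ((2 * n + 2) * b + 1) + 1) ρ β)
        {V | v + s < twistedMeanObs ρ β b n κ ψ V} ≤ ENNReal.ofReal s)
    (hδ0 : 0 ≤ δ) (hδ : 4 * ((windowCellsPlus n).card : ℝ) * δ < 1)
    (Typ : (Fin 4 → ℤ) → Set (LGConfig 4 G)) (hmeas : ∀ c, MeasurableSet (Typ c))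
    (hdep : ∀ c, DependsOn (fun σ : LGConfig 4 G => σ ∈ Typ c) ↑(cellEdges (stdFrame b) c))
    (hI : RowClauseI ρ β (stdFrame b) n ε Typ)
    (hanch' : ∀ c ∈ windowCellsPlus n,
      (wilsonMeasure (d := 4) (L := 2 * ((2 * n + 2) * b + 1) + 1) ρ β)
        {V | torusLift (2 * ((2 * n + 2) * b + 1) + 1) V ∉ Typ c} ≤ ENNReal.ofReal δ) : False := by
  classical
  -- budgets
  have hA1 : 0 < A + 1 := by linarith
  -- the rectangle width and the torus
  have hm : (((2 * n + 1) * b : ℕ) : ℤ) = (2 * (n : ℤ) + 1) * b := by push_cast; ring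
  set L : ℕ := 2 * ((2 * n + 2) * b + 1) + 1 with hL
  set μ := wilsonMeasure (d := 4) (L := L) ρ β with hμ
  haveI : IsProbabilityMeasure μ := isProbabilityMeasure_wilsonMeasure ρ hρ β
  set Λ := rowRegion b n with hΛ
  set m : ℕ := (2 * n + 1) * b with hmdef
  set F : LGConfig 4 G → ℝ := loopObs ρ b m with hFdef
  set Fψ : LGConfig 4 G → ℝ := fun U => ψ (loopObs ρ b m U) with hFψdef
  set Ψ : GaugeConfig 4 L G → ℝ := fun V => ∫ U, F U ∂(ymSpecification ρ β Λ (torusLift L V)) with hΨ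
  set Ψψ : GaugeConfig 4 L G → ℝ := fun V => ∫ U, Fψ U ∂(ymSpecification ρ β Λ (torusLift L V)) with hΨψ
  set Ψ' : GaugeConfig 4 L G → ℝ := twistedMeanObs ρ β b n κ ψ with hΨ'
  -- INPUT T: the twisted lifts are typical too (union bound over window+shell; outer measure, no measurability needed)
  set Ac : (Fin 4 → ℤ) → Set (GaugeConfig 4 L G) := fun c => {V | torusLift L V ∉ Typ c} with hAc
  set T : (Fin 4 → ℤ) → Set (GaugeConfig 4 L G) := fun c => {V | twistΦ b κ (torusLift L V) ∉ Typ c} with hTset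
  have hμT : ∀ c ∈ windowCellsPlus n, μ (T c) ≤ ENNReal.ofReal δ := fun c hc =>
    (hT β Typ hmeas hdep c hc).trans (hanch' c hc)
  set B : Set (GaugeConfig 4 L G) := ⋃ c ∈ windowCellsPlus n, (Ac c ∪ T c) with hB
  have hμB : μ B ≤ ENNReal.ofReal (2 * ((windowCellsPlus n).card : ℝ) * δ) := by
    calc μ B ≤ ∑ c ∈ windowCellsPlus n, μ (Ac c ∪ T c) := measure_biUnion_finset_le _ _
      _ ≤ ∑ c ∈ windowCellsPlus n, (ENNReal.ofReal δ + ENNReal.ofReal δ) :=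
          Finset.sum_le_sum fun c hc =>
            (measure_union_le _ _).trans (add_le_add (hanch' c hc) (hμT c hc))
      _ = ENNReal.ofReal (2 * ((windowCellsPlus n).card : ℝ) * δ) := by
          rw [Finset.sum_const, nsmul_eq_mul, ← ENNReal.ofReal_add hδ0 hδ0, ← ENNReal.ofReal_natCast,
            ← ENNReal.ofReal_mul (Nat.cast_nonneg _)]
          congr 1
          ring
  have hgood : ∀ V ∉ B, ∀ c ∈ windowCellsPlus n, c ∉ rowCells n →
      torusLift L V ∈ Typ c ∧ twistΦ b κ (torusLift L V) ∈ Typ c := by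
    intro V hV c hc _
    simp only [hB, Set.mem_iUnion, Set.mem_union, not_exists, not_or] at hV
    have h := hV c hc
    exact ⟨of_not_not h.1, of_not_not h.2⟩
  -- §11a on the good set: `Ψψ V − Ψ' V ≤ 2ε`
  have hF1 : ∀ U, |F U| ≤ 1 := abs_loopObs_le ρ hρu b _
  have hpair : ∀ V ∉ B, Ψψ V - Ψ' V ≤ 2 * ε := by
    intro V hV
    have hprop : Ψψ V = ∫ U, ψ (chargedTest ρ b m (torusLift L V) U).re
        ∂(ymSpecification ρ β Λ (torusLift L V)) := integral_comp_loopObs_eq ρ hρ β hm hψ _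
    have h2 := abs_integral_sub_le_of_rowClauseI ρ hρ hb hI (κ (torusLift L V))
      (u := fun U => ψ (chargedTest ρ b m (torusLift L V) U).re)
      (hψ.measurable.comp (Complex.measurable_re.comp (measurable_chargedTest ρ hρ b m _)))
      (fun U => hψ1 _ ((Complex.abs_re_le_norm _).trans (norm_chargedTest_le ρ hρu b m _ U)))
      (fun x y hxy => by
        show ψ (chargedTest ρ b m (torusLift L V) x).re = ψ (chargedTest ρ b m (torusLift L V) y).re
        rw [chargedTest_isCylinder ρ hb m _ hxy])
      (torusLift L V) (hgood V hV)
    rw [hprop]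
    exact (le_abs_self _).trans h2
  -- INPUT F: the bad-value set
  set C : Set (GaugeConfig 4 L G) := {V | v + s < Ψ' V} with hC
  have hμC : μ C ≤ ENNReal.ofReal s := hFat
  -- freezing + domination + Markov: the low-shaped-loop set
  set D : Set (GaugeConfig 4 L G) := {V | s ≤ 1 - Ψψ V} with hD
  have hFψ1 : ∀ U, |Fψ U| ≤ 1 := fun U => hψ1 _ (hF1 U)
  have hΨ1 : ∀ V, |Ψ V| ≤ 1 := fun V => abs_integral_ymSpecification_le ρ hρ β Λ hF1 _
  have hΨψ1 : ∀ V, |Ψψ V| ≤ 1 := fun V => abs_integral_ymSpecification_le ρ hρ β Λ hFψ1 _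
  have hFψc : Continuous Fψ := hψ.comp (continuous_loopObs ρ hρ b _)
  have hΨm : Measurable Ψ :=
    ((continuous_integral_ymSpecification ρ hρ β Λ (continuous_loopObs ρ hρ b _) hF1).comp
      (continuous_torusLift L)).measurable
  have hΨψm : Measurable Ψψ :=
    ((continuous_integral_ymSpecification ρ hρ β Λ hFψc hFψ1).comp (continuous_torusLift L)).measurable
  have hΨi : Integrable Ψ μ :=
    (integrable_const (1 : ℝ)).mono' hΨm.aestronglyMeasurable
      (ae_of_all _ fun V => by simpa [Real.norm_eq_abs] using hΨ1 V)
  have hΨψi : Integrable Ψψ μ :=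
    (integrable_const (1 : ℝ)).mono' hΨψm.aestronglyMeasurable
      (ae_of_all _ fun V => by simpa [Real.norm_eq_abs] using hΨψ1 V)
  have h1Ψi : Integrable (fun V => 1 - Ψ V) μ := (integrable_const _).sub hΨi
  have h1Ψψi : Integrable (fun V => 1 - Ψψ V) μ := (integrable_const _).sub hΨψi
  -- pointwise domination `1 − Ψψ ≤ A (1 − Ψ)` (the shaped loop is dominated near the frozen value)
  have hdom : ∀ V, 1 - Ψψ V ≤ A * (1 - Ψ V) := by
    intro V
    haveI : IsProbabilityMeasure (ymSpecification ρ β Λ (torusLift L V)) :=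
      isProbabilityMeasure_ymSpecification ρ hρ β _ _
    have hiF : Integrable F (ymSpecification ρ β Λ (torusLift L V)) :=
      (integrable_const (1 : ℝ)).mono' (continuous_loopObs ρ hρ b _).measurable.aestronglyMeasurable
        (ae_of_all _ fun U => by simpa [Real.norm_eq_abs] using hF1 U)
    have hiFψ : Integrable Fψ (ymSpecification ρ β Λ (torusLift L V)) :=
      (integrable_const (1 : ℝ)).mono' hFψc.measurable.aestronglyMeasurable
        (ae_of_all _ fun U => by simpa [Real.norm_eq_abs] using hFψ1 U)
    have e1 : ∫ U, (1 - Fψ U) ∂(ymSpecification ρ β Λ (torusLift L V)) =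
        1 - ∫ U, Fψ U ∂(ymSpecification ρ β Λ (torusLift L V)) := by
      rw [integral_sub (integrable_const _) hiFψ, integral_const]
      simp only [Measure.real, measure_univ, ENNReal.toReal_one, smul_eq_mul, one_mul]
    have e2 : ∫ U, A * (1 - F U) ∂(ymSpecification ρ β Λ (torusLift L V)) =
        A * (1 - ∫ U, F U ∂(ymSpecification ρ β Λ (torusLift L V))) := by
      rw [integral_const_mul, integral_sub (integrable_const _) hiF, integral_const]
      simp only [Measure.real, measure_univ, ENNReal.toReal_one, smul_eq_mul, one_mul]
    have key : ∫ U, (1 - Fψ U) ∂(ymSpecification ρ β Λ (torusLift L V)) ≤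
        ∫ U, A * (1 - F U) ∂(ymSpecification ρ β Λ (torusLift L V)) :=
      integral_mono ((integrable_const _).sub hiFψ) (((integrable_const _).sub hiF).const_mul A)
        fun U => hψA _ (abs_le.1 (hF1 U)).2
    rw [e1, e2] at key
    exact key
  have hfreeze : 1 - s * s / (A + 1) ≤ ∫ V, F (torusLift L V) ∂μ := hfreeze0
  have hDLR : ∫ V, F (torusLift L V) ∂μ = ∫ V, Ψ V ∂μ := integral_loopObs_torus ρ hρ hρu β hm
  have hE : ∫ V, (1 - Ψ V) ∂μ ≤ s * s / (A + 1) := by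
    rw [integral_sub (integrable_const _) hΨi, integral_const]
    simp only [Measure.real, measure_univ, ENNReal.toReal_one, smul_eq_mul, one_mul]
    linarith
  have hEψ : ∫ V, (1 - Ψψ V) ∂μ ≤ s * s := by
    have h3 : A * (s * s / (A + 1)) ≤ s * s := by
      rw [mul_div_assoc', div_le_iff₀ hA1]
      nlinarith [mul_pos hs0 hs0]
    calc ∫ V, (1 - Ψψ V) ∂μ ≤ ∫ V, A * (1 - Ψ V) ∂μ := integral_mono h1Ψψi (h1Ψi.const_mul A) hdom
      _ = A * ∫ V, (1 - Ψ V) ∂μ := integral_const_mul _ _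
      _ ≤ A * (s * s / (A + 1)) := mul_le_mul_of_nonneg_left hE hA
      _ ≤ s * s := h3
  have hMarkov : s * μ.real D ≤ ∫ V, (1 - Ψψ V) ∂μ :=
    mul_meas_ge_le_integral_of_nonneg (ae_of_all _ fun V => by
      have := (abs_le.1 (hΨψ1 V)).2; show (0 : ℝ) ≤ 1 - Ψψ V; linarith) h1Ψψi s
  have hμD : μ.real D ≤ s := by
    have : s * μ.real D ≤ s * s := hMarkov.trans hEψ
    exact le_of_mul_le_mul_left this hs0
  -- the three bad sets do not cover the torus
  have hμB' : μ.real B ≤ 2 * ((windowCellsPlus n).card : ℝ) * δ :=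
    ENNReal.toReal_le_of_le_ofReal (by positivity) hμB
  have hμC' : μ.real C ≤ s := ENNReal.toReal_le_of_le_ofReal hs0.le hμC
  have hcover : μ.real (B ∪ C ∪ D) < 1 := by
    calc μ.real (B ∪ C ∪ D) ≤ μ.real (B ∪ C) + μ.real D := measureReal_union_le _ _
      _ ≤ μ.real B + μ.real C + μ.real D := by
          have := measureReal_union_le (μ := μ) B C; linarith
      _ < 1 := by nlinarith
  have hex : ∃ V, V ∉ B ∪ C ∪ D := by
    by_contra hne
    push Not at hne
    have huniv : B ∪ C ∪ D = Set.univ := Set.eq_univ_of_forall hne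
    rw [huniv] at hcover
    simp [Measure.real] at hcover
  obtain ⟨V, hV⟩ := hex
  simp only [Set.mem_union, not_or] at hV
  obtain ⟨⟨hVB, hVC⟩, hVD⟩ := hV
  have h1 : Ψψ V - Ψ' V ≤ 2 * ε := hpair V hVB
  have h2 : Ψ' V ≤ v + s := not_lt.1 hVC
  have h3 : 1 - Ψψ V < s := not_le.1 hVD
  linarith

end Core

end Summit.QuantumFields.YangMills.Cruxes.IR.RowFloorPoly

end
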